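import Literature.Geometry.Riemannian.EvolvingNecks
import Mathlib.Analysis.InnerProductSpace.Calculus
import Mathlib.Analysis.SpecialFunctions.SmoothTransition
import Mathlib.Analysis.Calculus.Deriv.Inv
import HarnessLib

/-!
# `ε`-necks in the `C^{[1/ε]}` topology (Chen–Zhu 2006, §2; Hamilton 1997, §3.2 (C2))
(topic `Geometry/Riemannian`)

Layer RF4₁ of the decomposition of `Literature.Geometry.Riemannian.hamilton_chen_tang_zhu`
(`HamiltonPICProofs.lean`): the **faithful, `C^k` form** of the neck notions whose `C⁰` shadows
are `Necks.lean` / `EvolvingNecks.lean`. Chen–Zhu (J. Differential Geom. 74 (2006), §2, arXiv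
p. 4) call an open `N ⊂ (Mⁿ, g)` an `ε`-neck of radius `r` if "`(N, r⁻² g)` is `ε`-close, in
`C^{[ε⁻¹]}` topology, to a standard neck `Sⁿ⁻¹ × 𝕀` with `𝕀` of the length `2ε⁻¹` and `Sⁿ⁻¹`
of the scalar curvature `1`"; the `C^k`-closeness of a metric `ĝ` on the standard neck to the
standard metric `ḡ` is Hamilton's (Comm. Anal. Geom. 5 (1997), §3.2 (C2), p. 31, conditions (A), (B)
with a constant scaling factor, p. 31: "it suffices to find a single constant `r` so that if
`ĝ = g̃/r²` then `|ĝ - ḡ|_ḡ < ε'` and `|D̄ʲ ĝ|_ḡ < ε'` for `1 ≤ j ≤ k'`"): the `ḡ`-norms of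
`ĝ - ḡ` and of the iterated covariant derivatives `D̄ʲ ĝ` of `ĝ` with respect to the Levi-Civita
connection `D̄` of `ḡ` are `< ε` for `1 ≤ j ≤ k`, here with `k = [ε⁻¹]`.

## The model

To make `D̄ʲ` elementary we realise the standard neck conformally in a vector space. For
`m ≥ 2` put `c = m(m-1)` (`neckScale m`; the round `m`-sphere of radius `√c` has scalar curvature
`1`) and `F = ℝᵐ⁺¹` (`EuclideanSpace ℝ (Fin (m+1))`). The polar map
`Φ(θ, z) = e^{z/√c} θ : Sᵐ × ℝ → F ∖ {0}` is a diffeomorphism with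
`Φ^*(c |x|⁻² δ) = c e^{-2z/√c} |d(e^{z/√c} θ)|² = dz² + c g_round` (as `|θ| = 1`, `θ · dθ = 0`),
i.e. it is an **isometry of Chen–Zhu's standard cylinder `(Sᵐ × ℝ, c g_round + dz²)`
(`standardNeckMetric` of `Necks.lean`) onto `(F ∖ 0, ḡ)`, `ḡ = c |x|⁻² ⟨·,·⟩`** (`cylTensor`),
carrying the standard neck `Sᵐ × (-L, L)` onto the annulus
`A(L) = {e^{-L/√c} < |x| < e^{L/√c}}` (`neckAnnulus m L`) and the evolving round cylinder
`a(s) g_round + dz²`, `a(s) = (m-1)(m-2s)` (`evolvingNeckMetric` of `EvolvingNecks.lean`), onto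
`ḡ_s = a(s)|x|⁻²⟨·,·⟩ + (c - a(s))|x|⁻⁴⟨x,·⟩⟨x,·⟩` (`evolvingCylTensor`). On the open subset
`F ∖ 0` of the vector space `F` all tangent spaces are `F`, a `(0,q)`-tensor field is a function
`T : F → (Fin q → F) → ℝ` (multilinear in practice; no multilinearity is needed to *state* the
definitions, and on multilinear `T` the norm below is the invariant `ḡ`-norm), and the
Levi-Civita connection `D̄` of the conformally flat `ḡ = e^{2φ}δ`, `φ = log √c - log |x|`, is
`D̄_v w = ∂_v w + Γ_x(v, w)` with the classical Christoffel map of a conformal metric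
`Γ_x(v,w) = (∂_wφ) v + (∂_vφ) w - ⟨v,w⟩ ∇φ = -|x|⁻²(⟨w,x⟩ v + ⟨v,x⟩ w - ⟨v,w⟩ x)`
(`cylChristoffel`; symmetric = torsion free, and `D̄ḡ = 0` is PROVED below,
`cylCovDeriv_cylTensor`, so `Γ` is the Levi-Civita connection of `ḡ` by uniqueness,
O'Neill 1983, Ch. 3, Thm. 3.11). Hence the iterated covariant derivative is the explicit recursion
`(D̄T)_x(v₀; v₁,…,v_q) = ∂_{v₀}(T(v₁,…,v_q))(x) - Σᵢ T_x(v₁,…,Γ_x(v₀,vᵢ),…,v_q)`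
(`cylCovDeriv`, `cylCovDerivIter`; O'Neill 1983, Ch. 3, Def. 3.16–3.17 with the product rule (2.13)), and the
`ḡ`-norm of a `(0,q)`-tensor at `x` is `|T|_ḡ = (|x|/√c)^q (Σ_a T(b_{a₁},…,b_{a_q})²)^{1/2}` over
the standard basis `b` of `F` (`cylNorm`; `{(|x|/√c) bᵢ}` is a `ḡ_x`-orthonormal basis).

## Definitions

* `PseudoRiemannianMetric.confSmul g f` — the conformal change `f • g` of a metric by a
  nowhere-vanishing `Cⁿ` function (used for the model metric on `F`).
* `neckScale`, `neckAnnulus`, `cylTensor`, `evolvingCylTensor`, `cylChristoffel`, `cylCovDeriv`,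
  `cylCovDerivIter`, `cylNorm` — the model, as above.
* `IsCkCloseOn m k ε U T̄ h` — **`h` is `ε`-close to `T̄` in `Cᵏ` on `U ⊆ F ∖ 0`** (Hamilton
  1997, §3.2 (C2), (A), (B)): `|h - T̄|_ḡ < ε` and `|D̄ʲ(h - T̄)|_ḡ < ε` for `1 ≤ j ≤ k`, pointwise on `U`
  (for the parallel references `T̄ = ḡ, ḡ_s` one has `D̄ʲ(h - T̄) = D̄ʲ h`, Hamilton's (B)).
* `neckPullback g a ψ` — the rescaled pulled-back metric `a · ψ^* g` as a tensor field on `F`.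
* `IsNeckChart m L ψ N` — `ψ : F → M` restricts to a diffeomorphism of the model neck `A(L)` onto
  the open set `N ⊆ M` (smooth injective immersion on `A(L)`, open onto its image `N`).
* `IsCkEpsNeck m g N ε r` — **`N` is an `ε`-neck of radius `r` of `(M, g)`** in the sense of
  Chen–Zhu 2006, §2, p. 4, with `C^{[ε⁻¹]}`-closeness read as Hamilton's (A), (B), `k = [ε⁻¹]`.
* `IsCkStrongEpsNeck m g S B t Q ε` — **strong `ε`-neck** (Chen–Zhu 2006, §5, p. 26 (a)): along
  one neck chart, for every rescaled time `s ∈ [-1, 0]` the slice `Q · g(t + s/Q)` is `ε`-close in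
  `C^{[ε⁻¹]}` to the evolving cylinder `ḡ_s`; the parabolic window `[t - Q⁻¹, t] ⊆ S`. Reading
  adopted for "ε-close in `C^{[ε⁻¹]}`" on the parabolic region: slice-wise spatial closeness with
  norms and covariant derivatives of the fixed time-zero standard metric `ḡ` (for which all `ḡ_s`
  are parallel); time derivatives of the flow are not separately constrained (along a Ricci flow
  they are the Ricci tensors of the slices).

## Main statements (all proved)

* `cylChristoffel_symm`, `cylCovDeriv_cylTensor` (`D̄ḡ = 0` on `F ∖ 0`), `cylCovDerivIter_zero`,
  locality `cylCovDerivIter_congr`, `isCkCloseOn_of_eqOn`.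
* `IsCkEpsNeck.isOpen`, `IsCkStrongEpsNeck.isCkEpsNeck` (the time-`t` slice of a strong neck at
  scale `Q` is an `ε`-neck of radius `Q^{-1/2}`).
* Non-vacuity: `isCkEpsNeck_cylMetricReg` — for the smooth Riemannian metric `cylMetricReg m L`
  on `F = ℝᵐ⁺¹` which equals `ḡ` on `A(L)` (a conformal regularisation of `ḡ` at the origin),
  the annulus `A(ε⁻¹)` is an `ε`-neck of radius `1`, chart `id`.

## References

* B.-L. Chen, X.-P. Zhu, *Ricci flow with surgery on four-manifolds with positive isotropic
  curvature*, J. Differential Geom. 74 (2006) 177–264, arXiv:math/0504478: §2, p. 4 (ε-necks);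
  §5, p. 26 (strong ε-necks). [ChenZhu2006]
* R. S. Hamilton, *Four-manifolds with positive isotropic curvature*, Comm. Anal. Geom. 5 (1997)
  1–92: §3.2 (C2), p. 31, conditions (A), (B) (geometrically `(ε, k)`-cylindrical necks). [Hamilton1997]
* B. O'Neill, *Semi-Riemannian geometry* (1983): Ch. 3, Thm. 3.11 (Levi-Civita connection),
  Def. 3.16–3.17 (covariant derivative and covariant differential of tensor fields as tensor
  derivations, product rule (2.13); "(D5) is equivalent to the parallelism of the metric
  tensor"). [ONeill1983]
-/

noncomputable section

open Bundle Set Function Metric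
open scoped Manifold ContDiff Topology RealInnerProductSpace

/-! ### Conformal change of a metric by a function -/

namespace Literature.Geometry.Riemannian
section PseudoRiemannianMetric
open Literature.Geometry.Lorentzian (PseudoRiemannianMetric)
open Literature.Geometry.Lorentzian.PseudoRiemannianMetric

variable
  {EB : Type*} [NormedAddCommGroup EB] [NormedSpace ℝ EB]
  {HB : Type*} [TopologicalSpace HB] {IB : ModelWithCorners ℝ EB HB} {n : ℕ∞ω}
  {B : Type*} [TopologicalSpace B] [ChartedSpace HB B]
  {F : Type*} [NormedAddCommGroup F] [NormedSpace ℝ F]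
  {E : B → Type*} [TopologicalSpace (TotalSpace F E)]
  [∀ b, TopologicalSpace (E b)] [∀ b, AddCommGroup (E b)] [∀ b, Module ℝ (E b)]
  [FiberBundle F E] [VectorBundle ℝ F E]

-- The instance search `∀ b, Module ℝ (E b →L[ℝ] E b →L[ℝ] ℝ)` behind `ContMDiff.smul_section`
-- needs more than the default heartbeats on this bundle of bilinear forms.
set_option synthInstance.maxHeartbeats 400000 in
/-- **Conformal change of a metric by a function.** For a `Cⁿ` function `f : B → ℝ` vanishing
nowhere, `g.confSmul f hf h0` is the pseudo-Riemannian metric `f • g`,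
`(f • g)_b(v, w) = f(b) g_b(v, w)`: symmetric, nondegenerate since `f b ≠ 0`, and `Cⁿ` by
Mathlib's `ContMDiff.smul_section`. For `f > 0` and `g` Riemannian this is the conformally
equivalent Riemannian metric `f g` (Besse 1987, §1.J, 1.159: `g₁ = e^{2φ} g`).
[cite: Besse1987, §1.J, 1.159] -/
def _root_.Literature.Geometry.Lorentzian.PseudoRiemannianMetric.confSmul (g : PseudoRiemannianMetric IB n F E) (f : B → ℝ) (hf : ContMDiff IB 𝓘(ℝ, ℝ) n f)
    (h0 : ∀ b, f b ≠ 0) : PseudoRiemannianMetric IB n F E where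
  val b := f b • g.val b
  symm b v w := by simp [g.symm b v w]
  nondegenerate b v hv := g.nondegenerate b v fun w ↦ by
    have h := hv w
    simp only [FunLike.coe_smul, Pi.smul_apply, smul_eq_mul, mul_eq_zero] at h
    exact h.resolve_left (h0 b)
  contMDiff := hf.smul_section g.contMDiff

/-- The value of `f • g` on vectors. [folklore] -/
@[simp]
theorem _root_.Literature.Geometry.Lorentzian.PseudoRiemannianMetric.confSmul_apply (g : PseudoRiemannianMetric IB n F E) (f : B → ℝ)
    (hf : ContMDiff IB 𝓘(ℝ, ℝ) n f) (h0 : ∀ b, f b ≠ 0) (b : B) (v w : E b) :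
    (g.confSmul f hf h0).val b v w = f b * g.val b v w := by
  simp [confSmul]

/-- A positive conformal change of a Riemannian metric is Riemannian. [folklore] -/
theorem _root_.Literature.Geometry.Lorentzian.PseudoRiemannianMetric.IsRiemannian.confSmul {g : PseudoRiemannianMetric IB n F E} (hg : g.IsRiemannian)
    {f : B → ℝ} (hf : ContMDiff IB 𝓘(ℝ, ℝ) n f) (hpos : ∀ b, 0 < f b) :
    (g.confSmul f hf fun b ↦ (hpos b).ne').IsRiemannian := by
  intro b v hv
  rw [confSmul_apply]
  exact mul_pos (hpos b) (hg b v hv)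

end PseudoRiemannianMetric
end Literature.Geometry.Riemannian

namespace Literature.Geometry.Riemannian

open Lorentzian Lorentzian.PseudoRiemannianMetric

/-- Local notation: `𝔽 m = ℝᵐ⁺¹`, the vector space containing the model necks. -/
local notation "𝔽 " m:arg => EuclideanSpace ℝ (Fin (m + 1))

/-! ### The model: scale, annulus, reference tensors, Christoffel map -/

section Model

/-- Chen–Zhu's normalisation `c = m(m-1)` of the standard neck (the round `Sᵐ` of radius `√c`
has scalar curvature `1`; junk value `1` for `m ≤ 1`): the time-zero value of
`evolvingNeckFactor`. [cite: ChenZhu2006, §2, p. 4] -/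
def neckScale (m : ℕ) : ℝ := evolvingNeckFactor m 0

/-- The scale is positive. [folklore] -/
theorem neckScale_pos (m : ℕ) : 0 < neckScale m := evolvingNeckFactor_pos m 0

/-- For `m ≥ 2`, `c = m(m-1)`. [cite: ChenZhu2006, §2, p. 4] -/
theorem neckScale_eq {m : ℕ} (hm : 2 ≤ m) : neckScale m = m * ((m : ℝ) - 1) := by
  simp [neckScale, evolvingNeckFactor_zero, hm]

/-- In the case of 4-manifolds (`m = 3`): `c = 6`. [cite: ChenZhu2006, §2, p. 4] -/
theorem neckScale_three : neckScale 3 = 6 := by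
  rw [neckScale_eq (by norm_num)]; norm_num

/-- **The model neck of half-length `L`**: the annulus
`A(L) = {x ∈ ℝᵐ⁺¹ | e^{-L/√c} < |x| < e^{L/√c}}`, the image of Chen–Zhu's standard neck
`Sᵐ × (-L, L)` under the polar isometry `Φ(θ, z) = e^{z/√c} θ` (module docstring).
[cite: ChenZhu2006, §2, p. 4] -/
def neckAnnulus (m : ℕ) (L : ℝ) : Set (𝔽 m) :=
  {x | Real.exp (-(L / Real.sqrt (neckScale m))) < ‖x‖ ∧ ‖x‖ < Real.exp (L / Real.sqrt (neckScale m))}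

variable {m : ℕ} {L : ℝ}

/-- Membership in the model neck. [folklore] -/
theorem mem_neckAnnulus {x : 𝔽 m} : x ∈ neckAnnulus m L ↔
    Real.exp (-(L / Real.sqrt (neckScale m))) < ‖x‖ ∧
      ‖x‖ < Real.exp (L / Real.sqrt (neckScale m)) := Iff.rfl

/-- The model neck is open. [folklore] -/
theorem isOpen_neckAnnulus (m : ℕ) (L : ℝ) : IsOpen (neckAnnulus m L) :=
  (isOpen_lt continuous_const continuous_norm).inter (isOpen_lt continuous_norm continuous_const)

/-- Points of the model neck are non-zero (have positive norm). [folklore] -/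
theorem norm_pos_of_mem_neckAnnulus {x : 𝔽 m} (hx : x ∈ neckAnnulus m L) : 0 < ‖x‖ :=
  (Real.exp_pos _).trans hx.1

/-- Points of the model neck are non-zero. [folklore] -/
theorem ne_zero_of_mem_neckAnnulus {x : 𝔽 m} (hx : x ∈ neckAnnulus m L) : x ≠ 0 :=
  norm_pos_iff.1 (norm_pos_of_mem_neckAnnulus hx)

/-- The unit sphere (the central sphere `z = 0`) lies in every model neck of positive
half-length. [folklore] -/
theorem mem_neckAnnulus_of_norm_eq_one (hL : 0 < L) {x : 𝔽 m} (hx : ‖x‖ = 1) :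
    x ∈ neckAnnulus m L := by
  have h : 0 < L / Real.sqrt (neckScale m) := div_pos hL (Real.sqrt_pos.2 (neckScale_pos m))
  refine ⟨?_, ?_⟩
  · rw [hx]; exact Real.exp_lt_one_iff.2 (by linarith)
  · rw [hx]; exact Real.one_lt_exp_iff.2 h

/-- The model neck of positive half-length is nonempty. [folklore] -/
theorem neckAnnulus_nonempty (m : ℕ) (hL : 0 < L) : (neckAnnulus m L).Nonempty :=
  ⟨EuclideanSpace.single 0 1, mem_neckAnnulus_of_norm_eq_one hL (by simp)⟩

/-- **The standard cylinder metric in the conformal model**: `ḡ_x(v, w) = c |x|⁻² ⟨v, w⟩` on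
`F ∖ 0`, the image of `c g_round + dz²` (`standardNeckMetric`) under the polar isometry, as a
`(0,2)`-tensor field `F → (Fin 2 → F) → ℝ` (junk at `x = 0`). [cite: ChenZhu2006, §2, p. 4] -/
def cylTensor (m : ℕ) (x : 𝔽 m) (v : Fin 2 → 𝔽 m) : ℝ :=
  neckScale m * (‖x‖ ^ 2)⁻¹ * ⟪v 0, v 1⟫

/-- **The evolving round cylinder in the conformal model** at time `s ≤ 0`:
`ḡ_s = a(s)|x|⁻²⟨·,·⟩ + (c - a(s))|x|⁻⁴⟨x,·⟩⟨x,·⟩`, the image of `a(s) g_round + dz²`,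
`a(s) = (m-1)(m-2s)` (`evolvingNeckMetric s`: the Ricci flow of round cylinders with scalar
curvature `1` at `s = 0`), using `g_round = |x|⁻²δ - (d log|x|)²`, `dz² = c (d log|x|)²`.
[cite: ChenZhu2006, §3, pp. 9–10] -/
def evolvingCylTensor (m : ℕ) (s : ℝ) (x : 𝔽 m) (v : Fin 2 → 𝔽 m) : ℝ :=
  evolvingNeckFactor m s * (‖x‖ ^ 2)⁻¹ * ⟪v 0, v 1⟫ +
    (neckScale m - evolvingNeckFactor m s) * ((‖x‖ ^ 2)⁻¹) ^ 2 * (⟪x, v 0⟫ * ⟪x, v 1⟫)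

/-- At time `0` the evolving cylinder is the standard one. [cite: ChenZhu2006, §3, pp. 9–10] -/
@[simp] theorem evolvingCylTensor_zero (m : ℕ) : evolvingCylTensor m 0 = cylTensor m := by
  funext x v
  simp [evolvingCylTensor, cylTensor, neckScale]

/-- **Christoffel map of the standard cylinder metric** `ḡ = e^{2φ}δ`, `φ = log √c - log|x|`:
`Γ_x(v, w) = (∂_wφ)v + (∂_vφ)w - ⟨v,w⟩∇φ = -|x|⁻²(⟨w,x⟩v + ⟨v,x⟩w - ⟨v,w⟩x)`, so that
`D̄_v W = ∂_v W + Γ(v, W)` is the Levi-Civita connection of `ḡ` on `F ∖ 0` (symmetric: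
`cylChristoffel_symm`; metric: `cylCovDeriv_cylTensor`; O'Neill 1983, Ch. 3, Thm. 3.11).
[cite: ONeill1983, Ch. 3, Thm. 3.11] -/
def cylChristoffel (m : ℕ) (x v w : 𝔽 m) : 𝔽 m :=
  -((‖x‖ ^ 2)⁻¹ • (⟪w, x⟫ • v + ⟪v, x⟫ • w - ⟪v, w⟫ • x))

/-- The Christoffel map is symmetric (the connection is torsion free). [cite: ONeill1983, Ch. 3, Thm. 3.11] -/
theorem cylChristoffel_symm (m : ℕ) (x v w : 𝔽 m) :
    cylChristoffel m x v w = cylChristoffel m x w v := by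
  unfold cylChristoffel
  rw [real_inner_comm w v, add_comm (⟪w, x⟫ • v)]

/-- **Covariant derivative of a `(0,q)`-tensor field on the conformal model** with respect to
the Levi-Civita connection of `ḡ`:
`(D̄T)_x(v₀; v₁, …, v_q) = ∂_{v₀}(y ↦ T_y(v₁, …, v_q))(x) - Σᵢ T_x(v₁, …, Γ_x(v₀, vᵢ), …, v_q)`
(derivative slot first; O'Neill 1983, Ch. 3, Def. 3.16–3.17: the covariant derivative `D_V A` of a
tensor field as the tensor derivation extending `D_V`, i.e. by the product rule (2.13)
`(D_V A)(X₁,…,X_s) = V(A(X₁,…,X_s)) - Σᵢ A(X₁,…,D_V Xᵢ,…,X_s)`, here on constant fields `Xᵢ`).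
Tensor fields are bare functions `F → (Fin q → F) → ℝ`; `fderiv` is the junk `0` where the field
is not differentiable. [cite: ONeill1983, Ch. 3, Def. 3.16–3.17] -/
def cylCovDeriv {m q : ℕ} (T : 𝔽 m → (Fin q → 𝔽 m) → ℝ) (x : 𝔽 m) (v : Fin (q + 1) → 𝔽 m) : ℝ :=
  fderiv ℝ (fun y ↦ T y (Fin.tail v)) x (v 0) -
    ∑ i : Fin q, T x (update (Fin.tail v) i (cylChristoffel m x (v 0) (Fin.tail v i)))

/-- **Iterated covariant derivative** `D̄ʲ T` of a `(0,q)`-tensor field, a `(0, q+j)`-tensor field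
(Hamilton 1997, §3.2 (C2), p. 31, (B): "the covariant derivatives `D̄ʲĝ` with respect to the standard
metric `ḡ`"). [cite: Hamilton1997, §3.2 (C2), p. 31, (B)] -/
def cylCovDerivIter {m q : ℕ} (T : 𝔽 m → (Fin q → 𝔽 m) → ℝ) :
    (j : ℕ) → 𝔽 m → (Fin (q + j) → 𝔽 m) → ℝ
  | 0 => T
  | j + 1 => cylCovDeriv (cylCovDerivIter T j)

/-- **The `ḡ`-norm of a `(0,q)`-tensor at `x ≠ 0`**:
`|T|_ḡ(x) = (|x|/√c)^q (Σ_{a : Fin q → Fin (m+1)} T(b_{a₁}, …, b_{a_q})²)^{1/2}`, `b` the standard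
basis of `F` — the invariant norm `(Σ T(e_{a₁},…,e_{a_q})²)^{1/2}` over the `ḡ_x`-orthonormal basis
`eᵢ = (|x|/√c) bᵢ` when `T` is multilinear (Hamilton 1997, §3.2 (C2), p. 31: `|·|_ḡ`).
[cite: Hamilton1997, §3.2 (C2), p. 31, (A)–(B)] -/
def cylNorm (m q : ℕ) (x : 𝔽 m) (T : (Fin q → 𝔽 m) → ℝ) : ℝ :=
  (‖x‖ / Real.sqrt (neckScale m)) ^ q *
    Real.sqrt (∑ a : Fin q → Fin (m + 1), T (fun i ↦ EuclideanSpace.single (a i) (1 : ℝ)) ^ 2)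

/-- Norms are nonnegative. [folklore] -/
theorem cylNorm_nonneg (m q : ℕ) (x : 𝔽 m) (T : (Fin q → 𝔽 m) → ℝ) : 0 ≤ cylNorm m q x T :=
  mul_nonneg (pow_nonneg (div_nonneg (norm_nonneg _) (Real.sqrt_nonneg _)) _) (Real.sqrt_nonneg _)

/-- The zero tensor has norm `0`. [folklore] -/
@[simp] theorem cylNorm_zero (m q : ℕ) (x : 𝔽 m) : cylNorm m q x 0 = 0 := by
  simp [cylNorm]

/-- **`Cᵏ` `ε`-closeness on `U`** (Hamilton 1997, §3.2 (C2), p. 31, (A) `|ĝ - ḡ|_ḡ < ε`, (B)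
`|D̄ʲĝ|_ḡ < ε` for `1 ≤ j ≤ k`): the `(0,2)`-tensor field `h` on the model is `ε`-close in `Cᵏ`
on `U ⊆ F ∖ 0` to the reference field `T̄` if `|h - T̄|_ḡ < ε` and `|D̄ʲ(h - T̄)|_ḡ < ε`,
`1 ≤ j ≤ k`, at every point of `U` (for the parallel references `T̄ = ḡ`, `ḡ_s`:
`D̄ʲ(h - T̄) = D̄ʲh`). [cite: Hamilton1997, §3.2 (C2), p. 31, (A)–(B)] -/
def IsCkCloseOn (m k : ℕ) (ε : ℝ) (U : Set (𝔽 m)) (Tbar h : 𝔽 m → (Fin 2 → 𝔽 m) → ℝ) : Prop :=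
  ∀ x ∈ U, cylNorm m 2 x (h x - Tbar x) < ε ∧
    ∀ j : ℕ, 1 ≤ j → j ≤ k → cylNorm m (2 + j) x (cylCovDerivIter (h - Tbar) j x) < ε

end Model

/-! ### Calculus of the model connection -/

section Calculus

variable {m : ℕ}

/-- **`ḡ` is parallel**: `D̄ḡ = 0` on `F ∖ 0` — with the symmetry of `Γ`, this says that `Γ` is
the Christoffel map of the Levi-Civita connection of `ḡ = c|x|⁻²⟨·,·⟩` (O'Neill 1983, Ch. 3,
Thm. 3.11: the unique torsion-free metric connection; Def. 3.17 ff.: "(D5) is equivalent to the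
parallelism of the metric tensor `g`"). The computation:
`∂_{v₀}(c|y|⁻²⟨v₁,v₂⟩) = -2c|x|⁻⁴⟨x,v₀⟩⟨v₁,v₂⟩ = ḡ(Γ(v₀,v₁),v₂) + ḡ(v₁,Γ(v₀,v₂))`.
[cite: ONeill1983, Ch. 3, Thm. 3.11] -/
theorem cylCovDeriv_cylTensor {x : 𝔽 m} (hx : x ≠ 0) (v : Fin 3 → 𝔽 m) :
    cylCovDeriv (cylTensor m) x v = 0 := by
  have hN : ‖x‖ ^ 2 ≠ 0 := pow_ne_zero 2 (norm_ne_zero_iff.2 hx)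
  -- the derivative of `y ↦ c |y|⁻² ⟨v₁, v₂⟩` in the direction `v₀`
  have h1 : HasFDerivAt (fun y : 𝔽 m ↦ ‖y‖ ^ 2) (2 • innerSL ℝ x) x :=
    (hasStrictFDerivAt_norm_sq x).hasFDerivAt
  have h2 : HasFDerivAt (fun y : 𝔽 m ↦ (‖y‖ ^ 2)⁻¹) ((-((‖x‖ ^ 2) ^ 2)⁻¹) • (2 • innerSL ℝ x)) x :=
    (hasDerivAt_inv hN).comp_hasFDerivAt x h1
  have h3 : HasFDerivAt (fun y : 𝔽 m ↦ cylTensor m y (Fin.tail v))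
      (⟪Fin.tail v 0, Fin.tail v 1⟫ • (neckScale m • ((-((‖x‖ ^ 2) ^ 2)⁻¹) • (2 • innerSL ℝ x)))) x := by
    have := (h2.const_mul (neckScale m)).mul_const ⟪Fin.tail v 0, Fin.tail v 1⟫
    simpa [cylTensor] using this
  rw [cylCovDeriv, h3.fderiv]
  simp only [Fin.sum_univ_two, cylTensor, Fin.tail, update_self, ne_eq, one_ne_zero,
    not_false_eq_true, update_of_ne, zero_ne_one, Fin.succ_zero_eq_one, Fin.succ_one_eq_two,
    cylChristoffel, FunLike.coe_smul, Pi.smul_apply, innerSL_apply_apply, smul_eq_mul,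
    inner_neg_left, inner_neg_right, inner_smul_left, inner_smul_right, inner_add_left,
    inner_add_right, inner_sub_left, inner_sub_right, RCLike.conj_to_real]
  simp only [real_inner_comm x, real_inner_comm (v 0) (v 1)]
  field_simp
  ring

/-- The covariant derivative of the zero field vanishes. [folklore] -/
@[simp] theorem cylCovDeriv_zero (q : ℕ) :
    cylCovDeriv (m := m) (0 : 𝔽 m → (Fin q → 𝔽 m) → ℝ) = 0 := by
  funext x v
  simp [cylCovDeriv]

/-- All iterated covariant derivatives of the zero field vanish. [folklore] -/
@[simp] theorem cylCovDerivIter_zero (q j : ℕ) :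
    cylCovDerivIter (m := m) (0 : 𝔽 m → (Fin q → 𝔽 m) → ℝ) j = 0 := by
  induction j with
  | zero => rfl
  | succ j ih => simp [cylCovDerivIter, ih]

/-- **Locality**: fields agreeing on an open set have the same covariant derivative there.
[folklore] -/
theorem cylCovDeriv_congr {q : ℕ} {T T' : 𝔽 m → (Fin q → 𝔽 m) → ℝ} {U : Set (𝔽 m)}
    (hU : IsOpen U) (h : ∀ y ∈ U, T y = T' y) {x : 𝔽 m} (hx : x ∈ U) :
    cylCovDeriv T x = cylCovDeriv T' x := by
  funext v
  have he : (fun y ↦ T y (Fin.tail v)) =ᶠ[𝓝 x] fun y ↦ T' y (Fin.tail v) :=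
    Filter.eventually_of_mem (hU.mem_nhds hx) fun y hy ↦ by simp only [h y hy]
  simp only [cylCovDeriv, he.fderiv_eq, h x hx]

/-- Locality of the iterated covariant derivatives. [folklore] -/
theorem cylCovDerivIter_congr {q : ℕ} {T T' : 𝔽 m → (Fin q → 𝔽 m) → ℝ} {U : Set (𝔽 m)}
    (hU : IsOpen U) (h : ∀ y ∈ U, T y = T' y) (j : ℕ) {x : 𝔽 m} (hx : x ∈ U) :
    cylCovDerivIter T j x = cylCovDerivIter T' j x := by
  induction j generalizing x with
  | zero => exact h x hx
  | succ j ih => exact cylCovDeriv_congr hU (fun y hy ↦ ih hy) hx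

/-- A field vanishing on an open set has vanishing iterated covariant derivatives there.
[folklore] -/
theorem cylCovDerivIter_eq_zero_of_eqOn {q : ℕ} {T : 𝔽 m → (Fin q → 𝔽 m) → ℝ} {U : Set (𝔽 m)}
    (hU : IsOpen U) (h : ∀ y ∈ U, T y = 0) (j : ℕ) {x : 𝔽 m} (hx : x ∈ U) :
    cylCovDerivIter T j x = 0 := by
  rw [cylCovDerivIter_congr hU (T' := 0) h j hx, cylCovDerivIter_zero]
  rfl

/-- **A field equal to the reference on an open `U` is `ε`-close to it in every `Cᵏ`**, for every
`ε > 0` (all the differences and their covariant derivatives vanish on `U`). [folklore] -/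
theorem isCkCloseOn_of_eqOn {k : ℕ} {ε : ℝ} {U : Set (𝔽 m)} {Tbar h : 𝔽 m → (Fin 2 → 𝔽 m) → ℝ}
    (hU : IsOpen U) (hε : 0 < ε) (h_eq : ∀ x ∈ U, h x = Tbar x) : IsCkCloseOn m k ε U Tbar h := by
  intro x hx
  have h0 : ∀ y ∈ U, (h - Tbar) y = 0 := fun y hy ↦ by simp [h_eq y hy]
  refine ⟨?_, fun j _ _ ↦ ?_⟩
  · rw [h_eq x hx, sub_self, cylNorm_zero]; exact hε
  · rw [cylCovDerivIter_eq_zero_of_eqOn hU h0 j hx, cylNorm_zero]; exact hε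

/-- Closeness is monotone in `ε` and antitone in `k` and `U`. [folklore] -/
theorem IsCkCloseOn.mono {k k' : ℕ} {ε ε' : ℝ} {U U' : Set (𝔽 m)}
    {Tbar h : 𝔽 m → (Fin 2 → 𝔽 m) → ℝ} (hcl : IsCkCloseOn m k ε U Tbar h) (hk : k' ≤ k)
    (hε : ε ≤ ε') (hU : U' ⊆ U) : IsCkCloseOn m k' ε' U' Tbar h := fun x hx ↦
  ⟨(hcl x (hU hx)).1.trans_le hε, fun j hj hjk ↦ ((hcl x (hU hx)).2 j hj (hjk.trans hk)).trans_le hε⟩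

/-- The `C⁰` part of `Cᵏ`-closeness. [cite: Hamilton1997, §3.2 (C2), p. 31, (A)] -/
theorem IsCkCloseOn.c0 {k : ℕ} {ε : ℝ} {U : Set (𝔽 m)} {Tbar h : 𝔽 m → (Fin 2 → 𝔽 m) → ℝ}
    (hcl : IsCkCloseOn m k ε U Tbar h) {x : 𝔽 m} (hx : x ∈ U) :
    cylNorm m 2 x (h x - Tbar x) < ε := (hcl x hx).1

end Calculus

/-! ### Neck charts and `ε`-necks in the `C^{[1/ε]}` topology -/

section Necks

variable {E : Type*} [NormedAddCommGroup E] [NormedSpace ℝ E] {H : Type*} [TopologicalSpace H]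
  {I : ModelWithCorners ℝ E H} {M : Type*} [TopologicalSpace M] [ChartedSpace H M] {m : ℕ}

variable (I) in
/-- **`ψ` is a neck chart of half-length `L` onto `N`**: the map `ψ : F → M` (only its values on
the model neck `A(L)` matter) restricts to a diffeomorphism of `A(L)` onto the open subset
`N ⊆ M` — it is `C^∞`, injective and immersive on `A(L)`, maps `A(L)` onto `N`, and is open on
`A(L)` (so `N` and the images of open subsets of the neck are open). This is the "diffeomorphism
of the standard neck onto `N`" implicit in Chen–Zhu's "`(N, r⁻²g)` is `ε`-close to a standard
neck" (2006, §2, p. 4) and Hamilton's topological necks "a local diffeomorphism of a cylinder `N : Sⁿ⁻¹ × [a,b] → Mⁿ`"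
(1997, §3.2 (C2), p. 30; here injective, onto an open set), in the conformal model.
[cite: ChenZhu2006, §2, p. 4] [cite: Hamilton1997, §3.2 (C2), p. 30] -/
structure IsNeckChart (m : ℕ) (L : ℝ) (ψ : 𝔽 m → M) (N : Set M) : Prop where
  /-- `ψ` is smooth on the model neck. -/
  contMDiffOn : ContMDiffOn 𝓘(ℝ, 𝔽 m) I ∞ ψ (neckAnnulus m L)
  /-- `ψ` is injective on the model neck. -/
  injOn : InjOn ψ (neckAnnulus m L)
  /-- `ψ` maps the model neck onto `N`. -/
  image_eq : ψ '' neckAnnulus m L = N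
  /-- `ψ` is open on the model neck. -/
  isOpen_image : ∀ U : Set (𝔽 m), IsOpen U → U ⊆ neckAnnulus m L → IsOpen (ψ '' U)
  /-- `ψ` is an immersion on the model neck. -/
  injective_mfderiv : ∀ x ∈ neckAnnulus m L, Injective (mfderiv 𝓘(ℝ, 𝔽 m) I ψ x)

/-- The image of a neck chart is open. [folklore] -/
theorem IsNeckChart.isOpen {L : ℝ} {ψ : 𝔽 m → M} {N : Set M} (h : IsNeckChart I m L ψ N) :
    IsOpen N :=
  h.image_eq ▸ h.isOpen_image _ (isOpen_neckAnnulus m L) Subset.rfl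

/-- The image of a neck chart of positive half-length is nonempty. [folklore] -/
theorem IsNeckChart.nonempty {L : ℝ} {ψ : 𝔽 m → M} {N : Set M} (h : IsNeckChart I m L ψ N)
    (hL : 0 < L) : N.Nonempty :=
  h.image_eq ▸ (neckAnnulus_nonempty m hL).image ψ

/-- **The identity is a neck chart** of the model neck onto itself (in `M = F`). [folklore] -/
theorem isNeckChart_id (m : ℕ) (L : ℝ) :
    IsNeckChart 𝓘(ℝ, 𝔽 m) m L (id : 𝔽 m → 𝔽 m) (neckAnnulus m L) where
  contMDiffOn := contMDiff_id.contMDiffOn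
  injOn := injOn_id _
  image_eq := image_id _
  isOpen_image U hU _ := by simpa using hU
  injective_mfderiv x _ := by
    rw [mfderiv_id]
    exact fun v w h ↦ h

variable [IsManifold I ∞ M]

/-- **The rescaled pulled-back metric** `a · ψ^* g` as a `(0,2)`-tensor field on the model vector
space: `x ↦ ((v₀, v₁) ↦ a g_{ψ x}(dψ_x v₀, dψ_x v₁))` (`TangentSpace 𝓘(ℝ, F) x = F`
definitionally; Chen–Zhu's `r⁻² g` on the neck is `a = r⁻²`). [cite: ChenZhu2006, §2, p. 4] -/
def neckPullback (g : PseudoRiemannianMetric I ∞ E (TangentSpace I : M → Type _)) (a : ℝ)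
    (ψ : 𝔽 m → M) : 𝔽 m → (Fin 2 → 𝔽 m) → ℝ :=
  fun x v ↦ a * g.val (ψ x) (mfderiv 𝓘(ℝ, 𝔽 m) I ψ x (v 0)) (mfderiv 𝓘(ℝ, 𝔽 m) I ψ x (v 1))

/-- Unfolding `neckPullback`. [folklore] -/
theorem neckPullback_apply (g : PseudoRiemannianMetric I ∞ E (TangentSpace I : M → Type _))
    (a : ℝ) (ψ : 𝔽 m → M) (x : 𝔽 m) (v : Fin 2 → 𝔽 m) :
    neckPullback g a ψ x v =
      a * g.val (ψ x) (mfderiv 𝓘(ℝ, 𝔽 m) I ψ x (v 0)) (mfderiv 𝓘(ℝ, 𝔽 m) I ψ x (v 1)) := rfl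

/-- **`N` is an `ε`-neck of radius `r` of `(M, g)` in the `C^{[1/ε]}` topology** (Chen–Zhu 2006,
§2, arXiv p. 4: "an open subset `N ⊂ Mⁿ` [is] an `ε`-neck of radius `r` if `(N, r⁻²g)` is
`ε`-close, in `C^{[ε⁻¹]}` topology, to a standard neck `Sⁿ⁻¹ × 𝕀` with `𝕀` of the length `2ε⁻¹`
and `Sⁿ⁻¹` of the scalar curvature `1`"), the closeness read as Hamilton 1997, §3.2 (C2), p. 31, (A),
(B) with `k = [ε⁻¹]`: `ε, r > 0` and there is a neck chart `ψ` of half-length `ε⁻¹` onto `N`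
(`IsNeckChart`, in the conformal model `(A(ε⁻¹), ḡ) ≅ (Sᵐ × (-ε⁻¹, ε⁻¹), c g_round + dz²)`)
along which `r⁻² ψ^* g` is `ε`-close in `C^{[ε⁻¹]}` to `ḡ` (`IsCkCloseOn … (cylTensor m)`).
[cite: ChenZhu2006, §2, p. 4] [cite: Hamilton1997, §3.2 (C2), p. 31, (A)–(B)] -/
structure IsCkEpsNeck (m : ℕ) (g : PseudoRiemannianMetric I ∞ E (TangentSpace I : M → Type _))
    (N : Set M) (ε r : ℝ) : Prop where
  /-- `ε` and the radius `r` are positive. -/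
  pos : 0 < ε ∧ 0 < r
  /-- A neck chart with image `N` along which `r⁻² g` is `ε`-close in `C^{[1/ε]}` to the standard
  neck. -/
  exists_neckChart : ∃ ψ : 𝔽 m → M, IsNeckChart I m ε⁻¹ ψ N ∧
    IsCkCloseOn m ⌊ε⁻¹⌋₊ ε (neckAnnulus m ε⁻¹) (cylTensor m) (neckPullback g (r⁻¹ ^ 2) ψ)

variable {g : PseudoRiemannianMetric I ∞ E (TangentSpace I : M → Type _)} {N : Set M} {ε r : ℝ}

/-- The closeness parameter of a neck is positive. [folklore] -/
theorem IsCkEpsNeck.eps_pos (h : IsCkEpsNeck m g N ε r) : 0 < ε := h.pos.1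

/-- The radius of a neck is positive. [folklore] -/
theorem IsCkEpsNeck.radius_pos (h : IsCkEpsNeck m g N ε r) : 0 < r := h.pos.2

/-- A neck is open. [folklore] -/
theorem IsCkEpsNeck.isOpen (h : IsCkEpsNeck m g N ε r) : IsOpen N := by
  obtain ⟨ψ, hψ, -⟩ := h.exists_neckChart
  exact hψ.isOpen

/-- A neck is nonempty. [folklore] -/
theorem IsCkEpsNeck.nonempty (h : IsCkEpsNeck m g N ε r) : N.Nonempty := by
  obtain ⟨ψ, hψ, -⟩ := h.exists_neckChart
  exact hψ.nonempty (inv_pos.2 h.eps_pos)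

/-- **The `C⁰` part of a neck**: along a neck chart, `|r⁻²ψ^*g - ḡ|_ḡ < ε` pointwise on the
model neck (Hamilton's condition (A); the `C⁰` notion of `Necks.lean`, in the conformal model).
[cite: Hamilton1997, §3.2 (C2), p. 31, (A)] -/
theorem IsCkEpsNeck.exists_c0 (h : IsCkEpsNeck m g N ε r) :
    ∃ ψ : 𝔽 m → M, IsNeckChart I m ε⁻¹ ψ N ∧ ∀ x ∈ neckAnnulus m ε⁻¹,
      cylNorm m 2 x (neckPullback g (r⁻¹ ^ 2) ψ x - cylTensor m x) < ε := by
  obtain ⟨ψ, hψ, hcl⟩ := h.exists_neckChart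
  exact ⟨ψ, hψ, fun x hx ↦ hcl.c0 hx⟩

end Necks

/-! ### Strong `ε`-necks in the `C^{[1/ε]}` topology (Chen–Zhu 2006, §5, p. 26 (a)) -/

section Strong

variable {E : Type*} [NormedAddCommGroup E] [NormedSpace ℝ E] {H : Type*} [TopologicalSpace H]
  {I : ModelWithCorners ℝ E H} {M : Type*} [TopologicalSpace M] [ChartedSpace H M]
  [IsManifold I ∞ M] {m : ℕ}

/-- **`B` is a strong `ε`-neck at time `t`, at curvature scale `Q`, in the `C^{[1/ε]}` topology**,
for the family of metrics `g : ℝ → …` on the time set `S` (Chen–Zhu 2006, §5, arXiv p. 26, (a):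
"`B` is the slice at time `t` of the parabolic neighborhood `{(x', t') | x' ∈ B,
t' ∈ [t - R(x,t)⁻¹, t]}`, where the solution is well defined on the whole parabolic neighborhood
and is, after scaling with factor `R(x,t)` and shifting the time to zero, `ε`-close (in
`C^{[ε⁻¹]}` topology) to the subset `(𝕀 × S³) × [-1, 0]` of the evolving round cylinder
`ℝ × S³`, having scalar curvature one and length `2ε⁻¹` to `𝕀` at time zero"; `Q` stands for
`R(x,t)`): `ε, Q > 0`; `[t - Q⁻¹, t] ⊆ S`; and there is ONE neck chart `ψ` of half-length `ε⁻¹`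
onto `B` along which, for every rescaled time `s ∈ [-1, 0]`, `Q · ψ^* g(t + s/Q)` is `ε`-close in
`C^{[ε⁻¹]}` (`IsCkCloseOn`, norms and covariant derivatives of the time-zero standard metric `ḡ`)
to the evolving cylinder `ḡ_s` (`evolvingCylTensor m s`). The faithful (`Cᵏ`) sibling of the `C⁰`
`IsStrongEpsNeck` of `EvolvingNecks.lean`; see the module docstring for the reading of
"`C^{[ε⁻¹]}` on the parabolic region" adopted. [cite: ChenZhu2006, §5, p. 26, canonical neighborhood assumption (a)] -/
structure IsCkStrongEpsNeck (m : ℕ)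
    (g : ℝ → PseudoRiemannianMetric I ∞ E (TangentSpace I : M → Type _)) (S : Set ℝ)
    (B : Set M) (t Q ε : ℝ) : Prop where
  /-- `ε` and the scale `Q` are positive. -/
  pos : 0 < ε ∧ 0 < Q
  /-- The parabolic neighbourhood's times `[t - Q⁻¹, t]` belong to the time set of the flow. -/
  Icc_subset : Icc (t - Q⁻¹) t ⊆ S
  /-- One neck chart with image `B` along which the rescaled, time-shifted flow is `ε`-close in
  `C^{[1/ε]}` to the evolving round cylinder for all rescaled times `s ∈ [-1, 0]`. -/
  exists_neckChart : ∃ ψ : 𝔽 m → M, IsNeckChart I m ε⁻¹ ψ B ∧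
    ∀ s ∈ Icc (-1 : ℝ) 0, IsCkCloseOn m ⌊ε⁻¹⌋₊ ε (neckAnnulus m ε⁻¹) (evolvingCylTensor m s)
      (neckPullback (g (t + s / Q)) Q ψ)

variable {g : ℝ → PseudoRiemannianMetric I ∞ E (TangentSpace I : M → Type _)}
  {S : Set ℝ} {B : Set M} {t Q ε : ℝ}

/-- The base time of a strong neck belongs to the time set. [folklore] -/
theorem IsCkStrongEpsNeck.mem (h : IsCkStrongEpsNeck m g S B t Q ε) : t ∈ S :=
  h.Icc_subset ⟨by linarith [inv_pos.2 h.pos.2], le_rfl⟩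

/-- A strong neck is open. [folklore] -/
theorem IsCkStrongEpsNeck.isOpen (h : IsCkStrongEpsNeck m g S B t Q ε) : IsOpen B := by
  obtain ⟨ψ, hψ, -⟩ := h.exists_neckChart
  exact hψ.isOpen

/-- **The time-`t` slice of a strong `ε`-neck at scale `Q` is an `ε`-neck of radius `Q^{-1/2}`**
(take `s = 0`: `ḡ_0 = ḡ` and `(Q^{-1/2})⁻² = Q`).
[cite: ChenZhu2006, §5, p. 26, canonical neighborhood assumption (a)] -/
theorem IsCkStrongEpsNeck.isCkEpsNeck (h : IsCkStrongEpsNeck m g S B t Q ε) :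
    IsCkEpsNeck m (g t) B ε (Real.sqrt Q)⁻¹ := by
  obtain ⟨ψ, hψ, hclose⟩ := h.exists_neckChart
  refine ⟨⟨h.pos.1, inv_pos.2 (Real.sqrt_pos.2 h.pos.2)⟩, ψ, hψ, ?_⟩
  have h0 := hclose 0 ⟨by norm_num, le_rfl⟩
  rw [evolvingCylTensor_zero, zero_div, add_zero] at h0
  have hQ : ((Real.sqrt Q)⁻¹)⁻¹ ^ 2 = Q := by
    rw [inv_inv, Real.sq_sqrt h.pos.2.le]
  rwa [hQ]

end Strong

/-! ### Non-vacuity: the regularised model cylinder -/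

section ModelMetric

variable {m : ℕ}

/-- A smooth function `ρ_L : ℝ → ℝ` with `ρ_L(u) = u` for `u ≥ e^{-2L/√c}` (the squared inner
radius of `A(L)`) and `ρ_L > 0` on `[0, ∞)`: `ρ_L(u) = u + u₀ · smoothTransition(1 - u/u₀)`,
`u₀ = e^{-2L/√c}`. Used to extend `ḡ = c|x|⁻²δ` from the annulus to a smooth metric on all of `F`.
[folklore] -/
def radialReg (m : ℕ) (L : ℝ) (u : ℝ) : ℝ :=
  u + Real.exp (-(2 * L / Real.sqrt (neckScale m))) *
    Real.smoothTransition (1 - u / Real.exp (-(2 * L / Real.sqrt (neckScale m))))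

/-- `ρ_L` is smooth. [folklore] -/
theorem contDiff_radialReg (m : ℕ) (L : ℝ) : ContDiff ℝ ∞ (radialReg m L) := by
  unfold radialReg
  fun_prop (disch := exact Real.smoothTransition.contDiff)

/-- `ρ_L(u) = u` above the squared inner radius. [folklore] -/
theorem radialReg_eq_self {L u : ℝ} (hu : Real.exp (-(2 * L / Real.sqrt (neckScale m))) ≤ u) :
    radialReg m L u = u := by
  have hpos : 0 < Real.exp (-(2 * L / Real.sqrt (neckScale m))) := Real.exp_pos _
  have h1 : 1 - u / Real.exp (-(2 * L / Real.sqrt (neckScale m))) ≤ 0 := by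
    rw [sub_nonpos, le_div_iff₀ hpos, one_mul]; exact hu
  simp [radialReg, Real.smoothTransition.zero_of_nonpos h1]

/-- `ρ_L > 0` on `[0, ∞)`. [folklore] -/
theorem radialReg_pos {L u : ℝ} (hu : 0 ≤ u) : 0 < radialReg m L u := by
  set u₀ := Real.exp (-(2 * L / Real.sqrt (neckScale m))) with hu₀
  have hpos : 0 < u₀ := Real.exp_pos _
  unfold radialReg
  rw [← hu₀]
  rcases le_or_gt u₀ u with h | h
  · exact add_pos_of_pos_of_nonneg (hpos.trans_le h)
      (mul_nonneg hpos.le (Real.smoothTransition.nonneg _))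
  · have h1 : 0 < 1 - u / u₀ := by
      rw [sub_pos, div_lt_one hpos]; exact h
    exact add_pos_of_nonneg_of_pos hu (mul_pos hpos (Real.smoothTransition.pos_of_pos h1))

/-- On the model neck `A(L)`, `ρ_L(|x|²) = |x|²`. [folklore] -/
theorem radialReg_norm_sq {L : ℝ} {x : 𝔽 m} (hx : x ∈ neckAnnulus m L) :
    radialReg m L (‖x‖ ^ 2) = ‖x‖ ^ 2 := by
  refine radialReg_eq_self ?_
  have h1 := hx.1
  have hexp : Real.exp (-(2 * L / Real.sqrt (neckScale m))) =
      Real.exp (-(L / Real.sqrt (neckScale m))) ^ 2 := by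
    rw [← Real.exp_nat_mul]; congr 1; push_cast; ring
  rw [hexp]
  exact (pow_le_pow_left₀ (Real.exp_pos _).le h1.le 2)

/-- The conformal factor `x ↦ c / ρ_L(|x|²)` is smooth on `F`. [folklore] -/
theorem contMDiff_cylFactorReg (m : ℕ) (L : ℝ) :
    ContMDiff 𝓘(ℝ, 𝔽 m) 𝓘(ℝ, ℝ) ∞ fun x : 𝔽 m ↦ neckScale m * (radialReg m L (‖x‖ ^ 2))⁻¹ := by
  rw [contMDiff_iff_contDiff]
  refine contDiff_const.mul (ContDiff.inv ?_ fun x ↦ (radialReg_pos (sq_nonneg _)).ne')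
  exact (contDiff_radialReg m L).comp (contDiff_norm_sq ℝ)

/-- **The regularised standard cylinder** on `F = ℝᵐ⁺¹`: the smooth Riemannian metric
`(c / ρ_L(|x|²)) δ`, equal to `ḡ = c|x|⁻²δ` on the model neck `A(L)` (and smooth across the
origin). A device for the non-vacuity statement below, not a notion from the sources.
[folklore] -/
def cylMetricReg (m : ℕ) (L : ℝ) :
    PseudoRiemannianMetric 𝓘(ℝ, 𝔽 m) ∞ (𝔽 m) (TangentSpace 𝓘(ℝ, 𝔽 m) : 𝔽 m → Type _) :=
  (euclideanMetric (𝔽 m)).confSmul (fun x ↦ neckScale m * (radialReg m L (‖x‖ ^ 2))⁻¹)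
    (contMDiff_cylFactorReg m L)
    fun _ ↦ (mul_pos (neckScale_pos m) (inv_pos.2 (radialReg_pos (sq_nonneg _)))).ne'

/-- The regularised cylinder is Riemannian. [folklore] -/
theorem isRiemannian_cylMetricReg (m : ℕ) (L : ℝ) : (cylMetricReg m L).IsRiemannian :=
  isRiemannian_euclideanMetric.confSmul _
    fun _ ↦ mul_pos (neckScale_pos m) (inv_pos.2 (radialReg_pos (sq_nonneg _)))

/-- On the model neck the regularised cylinder is `ḡ`: its pullback by the identity at scale `1`
is `cylTensor`. [folklore] -/
theorem neckPullback_cylMetricReg_id {L : ℝ} {x : 𝔽 m} (hx : x ∈ neckAnnulus m L) :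
    neckPullback (I := 𝓘(ℝ, 𝔽 m)) (cylMetricReg m L) 1 id x = cylTensor m x := by
  funext v
  rw [neckPullback_apply, mfderiv_id, one_mul]
  change neckScale m * (radialReg m L (‖x‖ ^ 2))⁻¹ * (euclideanMetric (𝔽 m)).val x (v 0) (v 1) = _
  rw [euclideanMetric_apply, radialReg_norm_sq hx]
  rfl

/-- **Non-vacuity / the model case**: in `(ℝᵐ⁺¹, cylMetricReg m ε⁻¹)` — the standard cylinder
`ḡ` on the model neck — the model neck `A(ε⁻¹)` is an `ε`-neck of radius `1` in the `C^{[1/ε]}`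
topology, for every `ε > 0` (chart `id`; all differences and their covariant derivatives vanish).
[cite: ChenZhu2006, §2, p. 4] -/
theorem isCkEpsNeck_cylMetricReg (m : ℕ) {ε : ℝ} (hε : 0 < ε) :
    IsCkEpsNeck m (cylMetricReg m ε⁻¹) (neckAnnulus m ε⁻¹) ε 1 := by
  refine ⟨⟨hε, one_pos⟩, id, isNeckChart_id m ε⁻¹, ?_⟩
  simp only [inv_one, one_pow]
  exact isCkCloseOn_of_eqOn (isOpen_neckAnnulus m ε⁻¹) hε
    fun x hx ↦ neckPullback_cylMetricReg_id hx

end ModelMetric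

end Literature.Geometry.Riemannian

end
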